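import Summits.NavierStokesRegularity.NavierStokesRegularity.Theorems.PerpetualPumpEulerTypeIGlueFourierDeriv
import Literature.Analysis.FluidPDE.TaoAveragedSlotSobolev
import Literature.Analysis.UnboundedOperators.HeatKernelGaussianData
import Literature.Analysis.FluidPDE.MildSolution
import Literature.Analysis.UnboundedOperators.HeatSemigroupLpProofs
import Literature.Analysis.UnboundedOperators.HeatKernelSymbol

/-!
# Route PerpetualPump · `EulerTypeIGlue` — toolkit IV: Tao's heat propagator and pairing versus
# the tree's caloric extension and `L²` pairing of real fields

Support file for the support item `EulerTypeIGlue` (stmt-NavierStokesRegularity-1838). Tao's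
`H¹⁰_df`-mild solutions (`Literature/Analysis/FluidPDE/TaoAveragedSobolev.lean`) are written with
the Fourier-multiplier heat propagator `Tao2016.heat τ = 𝓕⁻¹ e^{-4π²τ|ξ|²} 𝓕` on `L²(ℝ³; ℂ³)` and
the complex bilinear pairing `Tao2016.pairing`; the tree's mild solutions in duality form
(`Literature.Analysis.FluidPDE.IsMildNSSolutionOn`) use the Gauss–Weierstrass integral
`heatFlow φ τ = heatKernel τ ⋆ φ` of real test fields and the real `L²` pairing. This file
identifies the two:

* `heat_toLp_eq_toLp_heatFlow` — for a real `L²` field `φ` and `τ ≥ 0`,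
  `heat τ [φ^ℂ] = [(heatFlow φ τ)^ℂ]` in `L²(ℝ³; ℂ³)` (both induce the tempered distribution
  `e^{τΔ} T_{[φ^ℂ]}`: the tree's `heatSemigroup_toTemperedDistribution_Lp_holds`, Mathlib's
  compatibility of the `L²` and `𝓢'` Fourier transforms, injectivity of `L² → 𝓢'`);
* `pairing_eq_integral_inner_of_ae_eq` — `pairing v [g^ℂ] = ∫ ⟪f, g⟫` when `v = [f^ℂ]`.

## References

* E. M. Stein, G. Weiss, *Introduction to Fourier Analysis on Euclidean Spaces* (1971), Ch. I,
  Thm. 1.18 and §3 (the Gauss–Weierstrass semigroup as a Fourier multiplier).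
* T. Tao, J. Amer. Math. Soc. 29 (2016), arXiv:1402.0290v3, §1.1 (1.5), (1.15). [Tao2016AveragedNS]
-/

noncomputable section

open MeasureTheory Set Filter Topology FourierTransform SchwartzMap TemperedDistribution
open scoped ENNReal NNReal FourierTransform RealInnerProductSpace Convolution

set_option linter.dupNamespace false

namespace Summit.NavierStokesRegularity.NavierStokesRegularity.Theorems.PerpetualPumpEulerTypeIGlue

open Literature.Analysis.FluidPDE Literature.Analysis.FluidPDE.Tao2016
open Literature.Analysis.UnboundedOperators (heatExtension heatKernel memLp_heatExtension_holds
  heatSymbol_hasTemperateGrowth_holds heatSymbol_hasTemperateGrowth_complex)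
open Literature.Analysis.FunctionSpaces.EuclideanSpace (complexify complexify_apply norm_complexify
  continuous_complexify)

/-- Local notation for physical / frequency space `ℝ³`. -/
local notation "ℝ³" => EuclideanSpace ℝ (Fin 3)
/-- Local notation for the complexified range `ℂ³`. -/
local notation "ℂ³" => EuclideanSpace ℂ (Fin 3)

/-! ### Injectivity of `L² → 𝓢'` -/

/-! ### Tao's heat propagator is the Gauss–Weierstrass integral -/

/-- For `τ ≥ 0` Tao's heat symbol is the (complexified) tree heat symbol `e^{-(2π)²τ|ξ|²}`. [folklore] -/
theorem heatSymbol_eq_of_nonneg {τ : ℝ} (hτ : 0 ≤ τ) (ξ : ℝ³) :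
    Tao2016.heatSymbol τ ξ = (Literature.Analysis.UnboundedOperators.heatSymbol τ ξ : ℂ) := by
  rw [Tao2016.heatSymbol, Literature.Analysis.UnboundedOperators.heatSymbol, max_eq_left hτ]
  congr 1
  congr 1
  ring

/-- **Tao's `e^{τΔ}` on `L²(ℝ³; ℂ³)` is the caloric extension** (`τ > 0`): the Fourier multiplier
`𝓕⁻¹ e^{-4π²τ|ξ|²} 𝓕 w` equals the Gauss–Weierstrass integral `heatKernel τ ⋆ w` as `L²` classes
(both are the tempered distribution `e^{τΔ} T_w`; Stein–Weiss Ch. I Thm. 1.18, §3). [folklore] -/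
theorem heat_eq_toLp_heatExtension {τ : ℝ} (hτ : 0 < τ) (w : L2C) :
    heat τ w = (memLp_heatExtension_holds (Lp.memLp w) one_le_two hτ).toLp (heatExtension (w : ℝ³ → ℂ³) τ) := by
  refine eq_of_toTemperedDistribution_eq ?_
  -- the right-hand side through the tree's `heatSemigroup_toTemperedDistribution_Lp_holds`
  haveI : Fact ((1 : ℝ≥0∞) ≤ 2) := ⟨one_le_two⟩
  have hR := Lp.heatSemigroup_toTemperedDistribution_Lp_holds (E := ℝ³) (F := ℂ³)
    memLp_heatExtension_holds w hτ
  -- symbols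
  set g : ℝ³ → ℂ := fun ξ => (Literature.Analysis.UnboundedOperators.heatSymbol τ ξ : ℂ) with hg
  have hgt : g.HasTemperateGrowth :=
    heatSymbol_hasTemperateGrowth_complex heatSymbol_hasTemperateGrowth_holds hτ.le
  have hgi : MemLp g ⊤ (volume : Measure ℝ³) := by
    refine (memLp_top_heatSymbol τ).ae_eq (Eventually.of_forall fun ξ => ?_)
    exact heatSymbol_eq_of_nonneg hτ.le ξ
  have hsymb : (memLp_top_heatSymbol τ).toLp (Tao2016.heatSymbol τ) = hgi.toLp g :=
    MemLp.toLp_congr _ _ (Eventually.of_forall fun ξ => heatSymbol_eq_of_nonneg hτ.le ξ)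
  -- the left-hand side through `𝓢'`
  have hL : (Lp.toTemperedDistribution (heat τ w) : 𝓢'(ℝ³, ℂ³)) =
      TemperedDistribution.heatSemigroup τ (Lp.toTemperedDistribution w) := by
    rw [heat, fourierMultiplier, hsymb, ← Lp.fourierInv_toTemperedDistribution_eq,
      Lp.toTemperedDistribution_smul_eq hgt hgi, ← Lp.fourier_toTemperedDistribution_eq,
      TemperedDistribution.heatSemigroup_eq_fourierMultiplierCLM, TemperedDistribution.fourierMultiplierCLM_apply]
  rw [hL]
  exact hR

/-- The caloric extension commutes with the complexification (a linear isometry commutes with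
the Bochner integral). [folklore] -/
theorem heatExtension_complexify_comp (φ : ℝ³ → ℝ³) (τ : ℝ) :
    heatExtension (complexify ∘ φ) τ = complexify ∘ heatExtension φ τ := by
  funext x
  rw [Literature.Analysis.UnboundedOperators.heatExtension_apply, Function.comp_apply,
    Literature.Analysis.UnboundedOperators.heatExtension_apply,
    ← LinearIsometry.integral_comp_comm complexify (fun y => heatKernel τ y • φ (x - y))]
  refine integral_congr_ae (Eventually.of_forall fun y => ?_)
  simp only [Function.comp_apply, complexify.map_smul]

/-- **Tao's `e^{τΔ}` of a real `L²` field is the tree's `heatFlow`** (`τ ≥ 0`):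
`heat τ [φ^ℂ] = [(heatFlow φ τ)^ℂ]` in `L²(ℝ³; ℂ³)`. [folklore] -/
theorem heat_toLp_eq_toLp_heatFlow {φ : ℝ³ → ℝ³} (hφ : MemLp (complexify ∘ φ) 2 (volume : Measure ℝ³))
    {τ : ℝ} (hτ : 0 ≤ τ) (hh : MemLp (complexify ∘ heatFlow φ τ) 2 (volume : Measure ℝ³)) :
    heat τ (hφ.toLp _) = hh.toLp _ := by
  rcases hτ.eq_or_lt with h0 | hpos
  · subst h0
    rw [heat_zero]
    exact MemLp.toLp_congr _ _ (Eventually.of_forall fun x => by rw [heatFlow_zero])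
  · rw [heat_eq_toLp_heatExtension hpos]
    refine MemLp.toLp_congr _ _ ?_
    rw [Literature.Analysis.UnboundedOperators.heatExtension_congr_ae' hφ.coeFn_toLp τ,
      heatExtension_complexify_comp, heatFlow_of_pos _ hpos]

/-! ### The pairing of complexified real fields -/

/-- The pairing of a general `L²` class against a complexified real field, when the class is
a.e. a complexified real field. [folklore] -/
theorem pairing_eq_integral_inner_of_ae_eq {v : L2C} {f g : ℝ³ → ℝ³}
    (hv : (v : ℝ³ → ℂ³) =ᵐ[volume] complexify ∘ f)
    (hg : MemLp (complexify ∘ g) 2 (volume : Measure ℝ³)) :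
    Tao2016.pairing v (hg.toLp _) = ((∫ x, ⟪f x, g x⟫ : ℝ) : ℂ) := by
  unfold Tao2016.pairing
  rw [← integral_complex_ofReal]
  refine integral_congr_ae ?_
  filter_upwards [hv, hg.coeFn_toLp] with x hx hy
  rw [hx, hy, Function.comp_apply, Function.comp_apply, cdot_complexify]

end Summit.NavierStokesRegularity.NavierStokesRegularity.Theorems.PerpetualPumpEulerTypeIGlue

end
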